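import Mathlib
import Literature.Computability.AlgebraicComplexity.StandardFamilies
import Literature.Computability.Complexity.NullstellensatzRefutation
import Literature.RingTheory.Nullstellensatz.SkodaBrownawellDegreeBound
import Summits.ValiantsHypothesis.ValiantsHypothesis.Theses.RefutationDegree
import Summits.ValiantsHypothesis.ValiantsHypothesis.Theorems.RefutationDegreeDefs
import Summits.ValiantsHypothesis.ValiantsHypothesis.Theorems.RefutationDegreeCertWindowQPCoeffDegree
import Summits.ValiantsHypothesis.ValiantsHypothesis.Theorems.RefutationDegreeRefutationBarrierStubHasSosRefOfHasNsRef
import Summits.ValiantsHypothesis.ValiantsHypothesis.Theorems.RefutationDegreeRefutationBarrierConverse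

/-!
# Crux `RefutationBarrier` (stmt-ValiantsHypothesis-5642), line `Sketch-ideator1`: the crux FORCES
super-polynomial arc contact (the transfer C⁺ is lossless), modulo Skoda–Brownawell

Lead's file.  The line reduces the crux to its transfer target C⁺ = `ContactQP` (super-polynomial
asymptotic contact of `per_n` with size-`(⌊n²/2⌋+1)` affine determinants): C⁺ ⟹ crux is
`refutationBarrier_of_contactQP` (T1 + T0).  Here the CONVERSE, modulo the named analytic fact
`skodaBrownawellDegreeBound` (Skoda 1972 / Brownawell 1987): NO pseudo-solutions of contact `D`
(`¬ ContactSeq n m D`, `m ≤ D`) is a Łojasiewicz inequality at infinity with exponent `D − m`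
(`loj_of_not_contactSeq`, elementary), which Skoda–Brownawell turns into a Nullstellensatz refutation
of degree `≤ ((n²+1)m² + 1)·D` (`hasNsRef_of_not_contactSeq`); contrapositively, the absence of
degree-`n^{c+9}` certificates asserted by the crux yields contact `n^c` (`contactQP_of_refutationBarrier`).
So `stub_contactQP` is EQUIVALENT to the crux (mod SB): the card's (C1),
"RefutationBarrier ⟺ κ(n, ⌊n²/2⌋+1) = n^{ω(1)}".
-/

-- `Summit.ValiantsHypothesis.ValiantsHypothesis.…` is the tree's mandated single-conjunct layout
-- (Sub = Summit), so the duplicated namespace component is intended.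
set_option linter.dupNamespace false

noncomputable section

namespace Summit.ValiantsHypothesis.ValiantsHypothesis.Theorems.RefutationDegree

open scoped BigOperators
open Filter Topology MvPolynomial
open Literature.Computability.Complexity
open Literature.RingTheory.Nullstellensatz (skodaBrownawellDegreeBound)
open Summit.ValiantsHypothesis.ValiantsHypothesis.Theses.RefutationDegree

/-- NO CONTACT-`D` PSEUDO-SOLUTIONS IS A ŁOJASIEWICZ INEQUALITY WITH EXPONENT `D − m` (sup norm):
`(1 + ‖a‖)^{2(D-m)} · Σ_{μ ∈ supp P} |P.coeff μ (a)|² ≥ ε > 0` uniformly on unknown-space (otherwise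
points violating it with `ε = 1/(k+1)` form a contact sequence). [folklore] -/
theorem loj_of_not_contactSeq {n m D : ℕ} (h : ¬ ContactSeq n m D) :
    ∃ ε : ℝ, 0 < ε ∧ ∀ a : Unk n m → ℂ,
      ε ≤ (1 + ‖a‖) ^ (2 * (D - m)) *
        ∑ μ ∈ (defect n m).support, ‖MvPolynomial.eval a ((defect n m).coeff μ)‖ ^ 2 := by
  classical
  by_contra hcon
  push Not at hcon
  choose a ha using fun k : ℕ => hcon (1 / ((k : ℝ) + 1)) (by positivity)
  apply h
  refine ⟨a, fun μ => ?_⟩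
  have hlim : Tendsto (fun k => (1 + ‖a k‖) ^ (2 * (D - m)) *
      ∑ ν ∈ (defect n m).support, ‖MvPolynomial.eval (a k) ((defect n m).coeff ν)‖ ^ 2)
      atTop (𝓝 0) :=
    squeeze_zero (fun k => by positivity) (fun k => (ha k).le) tendsto_one_div_add_atTop_nhds_zero_nat
  by_cases hμ : μ ∈ (defect n m).support
  · -- the square of the quantity is dominated by the whole weighted sum
    have hle : ∀ k, ((1 + ‖a k‖) ^ (D - m) * ‖MvPolynomial.eval (a k) ((defect n m).coeff μ)‖) ^ 2 ≤
        (1 + ‖a k‖) ^ (2 * (D - m)) *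
          ∑ ν ∈ (defect n m).support, ‖MvPolynomial.eval (a k) ((defect n m).coeff ν)‖ ^ 2 := by
      intro k
      rw [mul_pow, ← pow_mul, mul_comm (D - m) 2]
      refine mul_le_mul_of_nonneg_left ?_ (by positivity)
      exact Finset.single_le_sum
        (f := fun ν => ‖MvPolynomial.eval (a k) ((defect n m).coeff ν)‖ ^ 2)
        (fun ν _ => by positivity) hμ
    have hsq : Tendsto (fun k => ((1 + ‖a k‖) ^ (D - m) *
        ‖MvPolynomial.eval (a k) ((defect n m).coeff μ)‖) ^ 2) atTop (𝓝 0) :=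
      squeeze_zero (fun k => by positivity) hle hlim
    have := hsq.sqrt
    simpa [Real.sqrt_sq (show (0 : ℝ) ≤ (1 + ‖a _‖) ^ (D - m) *
      ‖MvPolynomial.eval (a _) ((defect n m).coeff μ)‖ by positivity)] using this
  · rw [MvPolynomial.notMem_support_iff] at hμ
    simp [hμ]

/-- Sup norm versus Euclidean size: `(1 + ‖a‖_∞)² ≤ 2 (1 + Σ_v |a_v|²)`. [folklore] -/
theorem one_add_norm_sq_le {σ : Type*} [Fintype σ] (a : σ → ℂ) :
    (1 + ‖a‖) ^ 2 ≤ 2 * (1 + ∑ v, ‖a v‖ ^ 2) := by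
  have hS : 0 ≤ ∑ v, ‖a v‖ ^ 2 := Finset.sum_nonneg fun v _ => by positivity
  have hnorm : ‖a‖ ≤ Real.sqrt (∑ v, ‖a v‖ ^ 2) := by
    refine (pi_norm_le_iff_of_nonneg (Real.sqrt_nonneg _)).2 fun v => ?_
    refine Real.le_sqrt_of_sq_le ?_
    exact Finset.single_le_sum (f := fun v => ‖a v‖ ^ 2) (fun v _ => by positivity)
      (Finset.mem_univ v)
  have hsq : ‖a‖ ^ 2 ≤ ∑ v, ‖a v‖ ^ 2 := by
    calc ‖a‖ ^ 2 ≤ (Real.sqrt (∑ v, ‖a v‖ ^ 2)) ^ 2 :=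
          pow_le_pow_left₀ (norm_nonneg _) hnorm 2
      _ = ∑ v, ‖a v‖ ^ 2 := Real.sq_sqrt hS
  nlinarith [norm_nonneg a, sq_nonneg (‖a‖ - 1)]

/-- **No contact ⟹ a Nullstellensatz certificate (modulo Skoda–Brownawell).** If Rep(n,m) has NO
asymptotic pseudo-solutions of contact `D ≥ m`, then it has a Nullstellensatz refutation with every
product of degree `≤ ((n²+1)m² + 1)·D` — exponent `D − m` at infinity (`loj_of_not_contactSeq`),
generator degree `m`, `(n²+1)m²` unknowns. -/
theorem hasNsRef_of_not_contactSeq {n m D : ℕ}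
    (hSB : skodaBrownawellDegreeBound (σ := Unk n m) (ι := (Fin n × Fin n) →₀ ℕ))
    (hmD : m ≤ D) (h : ¬ ContactSeq n m D) :
    HasNsRef n m ((Fintype.card (Unk n m) + 1) * D) := by
  obtain ⟨ε, hε, hloj⟩ := loj_of_not_contactSeq h
  set E : ℕ := D - m with hE
  have hED : E + m = D := by omega
  -- the Łojasiewicz hypothesis of Skoda–Brownawell, exponent `E`, constant `ε / 2^E`
  have hSBhyp : ∃ ε' : ℝ, 0 < ε' ∧ ∀ a : Unk n m → ℂ,
      ε' * (1 + ∑ v, ‖a v‖ ^ 2) ^ (-(E : ℝ)) ≤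
        ∑ μ ∈ (defect n m).support, ‖MvPolynomial.eval a ((defect n m).coeff μ)‖ ^ 2 := by
    refine ⟨ε / 2 ^ E, by positivity, fun a => ?_⟩
    set S : ℝ := 1 + ∑ v, ‖a v‖ ^ 2 with hSdef
    set T : ℝ := ∑ μ ∈ (defect n m).support, ‖MvPolynomial.eval a ((defect n m).coeff μ)‖ ^ 2
      with hTdef
    have hS : 1 ≤ S := by
      rw [hSdef]; exact le_add_of_nonneg_right (Finset.sum_nonneg fun v _ => by positivity)
    have hS0 : 0 < S := lt_of_lt_of_le one_pos hS
    have hT : 0 ≤ T := Finset.sum_nonneg fun μ _ => by positivity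
    -- `ε ≤ (1+‖a‖)^{2E} T ≤ (2 S)^E T`
    have h1 : ε ≤ (2 * S) ^ E * T := by
      refine (hloj a).trans ?_
      refine mul_le_mul_of_nonneg_right ?_ hT
      rw [pow_mul]
      exact pow_le_pow_left₀ (by positivity) (one_add_norm_sq_le a) E
    have h2 : (2 * S) ^ E = 2 ^ E * S ^ E := mul_pow 2 S E
    rw [Real.rpow_neg hS0.le, Real.rpow_natCast]
    rw [h2] at h1
    have hSE : 0 < S ^ E := pow_pos hS0 E
    have h2E : (0 : ℝ) < 2 ^ E := by positivity
    rw [div_mul_eq_mul_div, div_le_iff₀ h2E]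
    calc ε * (S ^ E)⁻¹ ≤ (2 ^ E * S ^ E * T) * (S ^ E)⁻¹ :=
          mul_le_mul_of_nonneg_right h1 (inv_nonneg.mpr hSE.le)
      _ = T * 2 ^ E := by field_simp
  have hns := hSB (defect n m).support (fun μ : (Fin n × Fin n) →₀ ℕ => (defect n m).coeff μ) m E
    (fun μ _ => Theorems.certWindowQP_coeffDegree n m μ) hSBhyp
  rw [hED] at hns
  exact hasNsRef_of_hasNSRefutationOfDegree hns

/-- Plain border membership is contact `D` for every `D ≤ m` (the weight `(1+‖A_k‖)^{D-m}` is `1`).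
[folklore] -/
theorem contactSeq_of_inBorder {n m D : ℕ} (hD : D ≤ m) (h : InBorder n m) : ContactSeq n m D := by
  obtain ⟨A, hA⟩ := h
  refine ⟨A, fun μ => ?_⟩
  have h0 : D - m = 0 := Nat.sub_eq_zero_of_le hD
  simpa [h0] using (tendsto_zero_iff_norm_tendsto_zero.mp (hA μ))

/-- The Skoda–Brownawell multiplier `(n²+1)(⌊n²/2⌋+1)² + 1` is `≤ n⁹` for `n ≥ 2`. -/
theorem card_unk_quadSize_succ_le (n : ℕ) (hn2 : 2 ≤ n) :
    Fintype.card (Unk n (n ^ 2 / 2 + 1)) + 1 ≤ n ^ 9 := by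
  have h := sb_budget_le_pow_nine hn2
  have hcard : (Fintype.card (Unk n (n ^ 2 / 2 + 1)) + 1) * (0 + (n ^ 2 / 2 + 1))
      = (n ^ 2 + 1) * (n ^ 2 / 2 + 1) ^ 3 + (n ^ 2 / 2 + 1) := sb_budget_eq n _
  have hpos : 1 ≤ n ^ 2 / 2 + 1 := Nat.succ_le_succ (Nat.zero_le _)
  calc Fintype.card (Unk n (n ^ 2 / 2 + 1)) + 1
      ≤ (Fintype.card (Unk n (n ^ 2 / 2 + 1)) + 1) * (0 + (n ^ 2 / 2 + 1)) :=
        Nat.le_mul_of_pos_right _ (by omega)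
    _ ≤ n ^ 9 := by rw [hcard]; exact h

/-- **The crux forces super-polynomial arc contact (mod Skoda–Brownawell)** — the converse of the
line's transfer `refutationBarrier_of_contactQP`: if `RefutationBarrier` holds then for every `c`,
eventually in `n`, Rep(n, ⌊n²/2⌋+1) has asymptotic pseudo-solutions of contact `n^c`
(`stub_contactQP`).  For `n^c ≥ m₁`: the crux at exponent `c + 9` forbids Hermitian-SOS, hence
Nullstellensatz, certificates of degree `n^{c+9} ≥ ((n²+1)m₁² + 1)·n^c`, so by
`hasNsRef_of_not_contactSeq` contact `n^c` cannot fail; for `n^c < m₁` contact `n^c` is plain border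
membership, supplied by `inBorder_of_refutationBarrier`. -/
theorem contactQP_of_refutationBarrier
    (hSB : ∀ n m : ℕ, skodaBrownawellDegreeBound (σ := Unk n m) (ι := (Fin n × Fin n) →₀ ℕ))
    (hB : RefutationBarrier) :
    ∀ c : ℕ, ∃ n₀ : ℕ, ∀ n ≥ n₀, ContactSeq n (n ^ 2 / 2 + 1) (n ^ c) := by
  intro c
  obtain ⟨n₁, hn₁⟩ := inBorder_of_refutationBarrier hSB hB
  have hB' := hB
  rw [refutationBarrier_iff] at hB'
  obtain ⟨n₀, hn₀⟩ := hB' (c + 9)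
  refine ⟨max (max n₀ n₁) 2, fun n hn => ?_⟩
  have hn0 : n₀ ≤ n := le_trans (le_trans (le_max_left _ _) (le_max_left _ _)) hn
  have hn1' : n₁ ≤ n := le_trans (le_trans (le_max_right _ _) (le_max_left _ _)) hn
  have hn2 : 2 ≤ n := le_trans (le_max_right _ _) hn
  rcases Nat.lt_or_ge (n ^ c) (n ^ 2 / 2 + 1) with hlt | hge
  · exact contactSeq_of_inBorder hlt.le (hn₁ n hn1')
  · by_contra hnc
    have hns := hasNsRef_of_not_contactSeq (hSB _ _) hge hnc
    have hsos := stub_hasSosRef_of_hasNsRef _ _ _ hns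
    refine hn₀ n hn0 _ le_rfl (hasSosRef_mono _ _ ?_ hsos)
    calc (Fintype.card (Unk n (n ^ 2 / 2 + 1)) + 1) * n ^ c ≤ n ^ 9 * n ^ c :=
          Nat.mul_le_mul_right _ (card_unk_quadSize_succ_le n hn2)
      _ = n ^ (c + 9) := by ring

end Summit.ValiantsHypothesis.ValiantsHypothesis.Theorems.RefutationDegree

end
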